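import Summits.ResolutionOfSingularities.ResolutionOfSingularities.Theorems.RisoStrataRisoCentresResolveDirCalculus
import Summits.ResolutionOfSingularities.ResolutionOfSingularities.Theorems.RisoStrataRisoCurvesHahn

/-!
# Route RisoStrata — crux `RisoCentresResolve` (stmt-ResolutionOfSingularities-18546), line `Sketch`:
# the typed TANGENT-CONE LEMMA (initial forms are invariant under the `W`-directions)

Typed form of Monreal's cone lemma (arXiv:2606.12554, Lemma 1.2 / Prop. 5.3: riso-trivial
directions lie in the lineality space of the tangent cone) for the route's inline predicate
`Rtd` (`Summits/…/Theses/RisoStrata.lean`): a family of arc coordinates `c a : J → k⟦t^ℚ⟧`,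
a straightener `φ` with clause (1) rv-straightening and clause (3) invariance of `φ`'s image
under positive `W`-translations.

* `cone_coeff_of_realise` — bookkeeping: if `y - x = t^e • u + O(t^{>e})` and `v x ≥ e` then
  `v y ≥ e` and `y_e = x_e + u`.
* `cone_initialForm` — **the cone lemma.** If a polynomial `P ∈ k[X_J]` vanishes on every arc
  (`P(c b) = 0` for all `b`; e.g. `P` a relation among the coordinates), `d₀` is at most the
  degree of every monomial of `P` (so `P_{d₀}` is the initial form when `d₀` is the least
  degree), `a` is an arc all of whose coordinates have order `≥ e > 0` with `t^e`-coefficient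
  vector `v`, then `P_{d₀}(v + u) = 0` for EVERY `u ∈ W`: the initial form is invariant under
  translation by `W` at every tangent vector realised by an arc. Mechanism: `dir_realise`
  (…DirCalculus) moves `a` to an arc `b` with `c b = c a + t^e u + O(t^{>e})`, and the relation
  `P(c b) = 0` read in degree `d₀ e` (`coeff_aeval_eq_eval_homogeneousComponent`, …RisoCurvesHahn)
  is `P_{d₀}(v + u) = 0`.
* `cone_initialForm_vertex` — at an arc sitting at the vertex (`c a = 0`): `P_{d₀}(u) = 0` for
  all `u ∈ W`, i.e. `W ⊆ V(in P)` for every relation `P`.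
* `cone_not_rtd_one` — criterion: if some arc sits at the vertex and for every direction
  `u ≠ 0` some relation `P` has an initial form with `P_{d₀}(u) ≠ 0` (the tangent cone contains
  no line through the vertex inside its lineality test set), then NO subspace `W ≠ 0` admits a
  straightener: the typed predicate fails for `r = 1` in the coordinates `c`.
* `cone_rtd_route` — the same for the route's arcs `Arc B m` and a presentation `g ⊆ m` of a
  subalgebra `B ⊆ K`: `Rtd`-data for `g` forces `P_{d₀}(v + u) = 0` for every relation
  `P(g) = 0` in `B`.

Characteristic-free; Mathlib + two landed tool files; no definitions, no named facts.
-/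

noncomputable section

set_option linter.dupNamespace false -- mandated namespace of this single-conjunct summit

namespace Summit.ResolutionOfSingularities.ResolutionOfSingularities.Theorems

section Cone

variable {k : Type} [Field k] {ι J : Type}

/-- Bookkeeping: `v x ≥ e` and `v (y - x - t^e u) > e` give `v y ≥ e` and `y_e = x_e + u`.
[folklore] -/
theorem cone_coeff_of_realise {x y : HahnSeries ℚ k} {e : ℚ} {u : k}
    (hx : (e : WithTop ℚ) ≤ x.orderTop)
    (h : (e : WithTop ℚ) < (y - x - HahnSeries.single e u).orderTop) :
    (e : WithTop ℚ) ≤ y.orderTop ∧ y.coeff e = x.coeff e + u := by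
  have hy : y = (y - x - HahnSeries.single e u) + x + HahnSeries.single e u := by ring
  have hs : (e : WithTop ℚ) ≤ (HahnSeries.single e u).orderTop := HahnSeries.orderTop_single_le
  constructor
  · rw [hy]
    refine le_trans ?_ (HahnSeries.min_orderTop_le_orderTop_add)
    refine le_min (le_trans ?_ (HahnSeries.min_orderTop_le_orderTop_add)) hs
    exact le_min h.le hx
  · rw [hy, HahnSeries.coeff_add, HahnSeries.coeff_add, HahnSeries.coeff_eq_zero_of_lt_orderTop h,
      zero_add, HahnSeries.coeff_single_same]

/-- **The typed cone lemma.** Clauses (1) and (3) of a typed straightener for the coordinates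
`c` and the subspace `W`; a polynomial `P` vanishing on all arcs; `d₀` below the degree of every
monomial of `P`; an arc `a` with all coordinates of order `≥ e > 0`. Then the degree-`d₀`
homogeneous component of `P` vanishes at `v + u` for every `u ∈ W`, where `v` is the vector of
`t^e`-coefficients of `c a`. [cite: Monreal2026, Thm 1.2 / Thm 4.13 (typed form)] -/
theorem cone_initialForm {c : ι → J → HahnSeries ℚ k} {W : Submodule k (J → k)} {φ : ι → J → HahnSeries ℚ k} (h1 : ∀ a b, a ≠ b → ∃ j, ∀ i, (c a j - c b j).orderTop < ((φ a i - φ b i) - (c a i - c b i)).orderTop) (h3 : ∀ a (w : J → HahnSeries ℚ k), (∀ i, 0 < (w i).orderTop) → w ∈ Submodule.span (HahnSeries ℚ k) ((fun u : J → k => fun i => HahnSeries.C (u i)) '' (W : Set (J → k))) → ∃ b, φ b = φ a + w) (P : MvPolynomial J k) (hP : ∀ b, MvPolynomial.aeval (c b) P = 0) (d₀ : ℕ) (hd₀ : ∀ d ∈ P.support, d₀ ≤ d.degree) (a : ι) {e : ℚ} (he : 0 < e) (hae : ∀ i, (e : WithTop ℚ) ≤ (c a i).orderTop) {u : J → k}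 (hu : u ∈ W) : MvPolynomial.eval (fun i => (c a i).coeff e + u i) (MvPolynomial.homogeneousComponent d₀ P) = 0 := by
  classical
  by_cases hu0 : u = 0
  · subst hu0
    have key := coeff_aeval_eq_eval_homogeneousComponent P (c a) he hae d₀ hd₀
    rw [hP a, HahnSeries.coeff_zero] at key
    simpa using key.symm
  · obtain ⟨b, -, hb⟩ := dir_realise h1 h3 a hu hu0 he
    have hb' : ∀ i, (e : WithTop ℚ) ≤ (c b i).orderTop ∧ (c b i).coeff e = (c a i).coeff e + u i :=
      fun i => cone_coeff_of_realise (hae i) (hb i)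
    have key := coeff_aeval_eq_eval_homogeneousComponent P (c b) he (fun i => (hb' i).1) d₀ hd₀
    rw [hP b, HahnSeries.coeff_zero] at key
    have hfun : (fun i => (c b i).coeff e) = fun i => (c a i).coeff e + u i := funext fun i => (hb' i).2
    rw [hfun] at key
    exact key.symm

/-- **Cone lemma at the vertex.** If the arc `a` sits at the vertex (`c a = 0`), then every
initial form of every polynomial vanishing on the arcs vanishes on `W`: `P_{d₀}(u) = 0` for all
`u ∈ W`. [cite: Monreal2026, Thm 1.2 / Thm 4.13 (typed form)] -/
theorem cone_initialForm_vertex {c : ι → J → HahnSeries ℚ k} {W : Submodule k (J → k)}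
    {φ : ι → J → HahnSeries ℚ k}
    (h1 : ∀ a b, a ≠ b → ∃ j, ∀ i,
      (c a j - c b j).orderTop < ((φ a i - φ b i) - (c a i - c b i)).orderTop)
    (h3 : ∀ a (w : J → HahnSeries ℚ k), (∀ i, 0 < (w i).orderTop) →
      w ∈ Submodule.span (HahnSeries ℚ k)
        ((fun u : J → k => fun i => HahnSeries.C (u i)) '' (W : Set (J → k))) →
      ∃ b, φ b = φ a + w)
    (P : MvPolynomial J k) (hP : ∀ b, MvPolynomial.aeval (c b) P = 0)
    (d₀ : ℕ) (hd₀ : ∀ d ∈ P.support, d₀ ≤ d.degree)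
    (a : ι) (ha : ∀ i, c a i = 0) {u : J → k} (hu : u ∈ W) :
    MvPolynomial.eval u (MvPolynomial.homogeneousComponent d₀ P) = 0 := by
  have hae : ∀ i, ((1 : ℚ) : WithTop ℚ) ≤ (c a i).orderTop := fun i => by
    rw [ha i, HahnSeries.orderTop_zero]; exact le_top
  have key := cone_initialForm h1 h3 P hP d₀ hd₀ a one_pos hae hu
  have hfun : (fun i => (c a i).coeff 1 + u i) = u := funext fun i => by
    rw [ha i, HahnSeries.coeff_zero, zero_add]
  rwa [hfun] at key

/-- **No line in the initial variety ⇒ no straightened direction.** If some arc sits at the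
vertex and every direction `u ≠ 0` is detected by the initial form of some polynomial vanishing
on the arcs (`P_{d₀}(u) ≠ 0` with `d₀` below all degrees of `P`), then clauses (1) and (3)
cannot hold for any subspace `W` of positive dimension. [folklore consequence] -/
theorem cone_not_rtd_one [Fintype J] {c : ι → J → HahnSeries ℚ k}
    (h0 : ∃ a, ∀ i, c a i = 0)
    (hdet : ∀ u : J → k, u ≠ 0 → ∃ (P : MvPolynomial J k) (d₀ : ℕ),
      (∀ b, MvPolynomial.aeval (c b) P = 0) ∧ (∀ d ∈ P.support, d₀ ≤ d.degree) ∧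
      MvPolynomial.eval u (MvPolynomial.homogeneousComponent d₀ P) ≠ 0) :
    ¬ ∃ W : Submodule k (J → k), 1 ≤ Module.finrank k W ∧
      ∃ φ : ι → J → HahnSeries ℚ k,
        (∀ a b, a ≠ b → ∃ j, ∀ i,
          (c a j - c b j).orderTop < ((φ a i - φ b i) - (c a i - c b i)).orderTop) ∧
        (∀ a i, 0 < (φ a i).orderTop) ∧
        (∀ a (w : J → HahnSeries ℚ k), (∀ i, 0 < (w i).orderTop) →
          w ∈ Submodule.span (HahnSeries ℚ k)
            ((fun u : J → k => fun i => HahnSeries.C (u i)) '' (W : Set (J → k))) →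
          ∃ b, φ b = φ a + w) := by
  rintro ⟨W, hW, φ, h1, -, h3⟩
  obtain ⟨a, ha⟩ := h0
  obtain ⟨u, hu⟩ : ∃ u : W, u ≠ 0 := by
    have : 0 < Module.finrank k W := hW
    rw [Module.finrank_pos_iff_exists_ne_zero] at this
    exact this
  have hu0 : (u : J → k) ≠ 0 := fun h => hu (Subtype.ext h)
  obtain ⟨P, d₀, hP, hd₀, hne⟩ := hdet u hu0
  exact hne (cone_initialForm_vertex h1 h3 P hP d₀ hd₀ a ha u.2)

end Cone

/-! ## The route's arcs -/

section Route

/-- **Cone lemma for the route's arcs.** For a subalgebra `B ⊆ K`, an ideal `m`, coordinates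
`g : J → B` and `Rtd`-data `(W, φ)` satisfying clauses (1) and (3) of the route's inline
predicate: every relation `P(g) = 0` in `B` has all its low-degree homogeneous components
`P_{d₀}` (`d₀` below all degrees of `P`) invariant under `W` at the tangent vectors of arcs:
`P_{d₀}(v + u) = 0`, `v` the `t^e`-coefficient vector of an arc of order `≥ e > 0`, `u ∈ W`.
[cite: Monreal2026, Thm 1.2 / Thm 4.13 (typed form)] -/
theorem cone_rtd_route : ∀ {k : Type} [Field k] {K : Type} [Field K] [Algebra k K] (B : Subalgebra k K) (m : Ideal ↥B) {J : Type} (g : J → ↥B) (W : Submodule k (J → k)) (φ : {α : ↥B →ₐ[k] HahnSeries ℚ k // ∀ b ∈ m, 0 < (α b).orderTop} → J → HahnSeries ℚ k), (∀ a b : {α : ↥B →ₐ[k] HahnSeries ℚ k // ∀ b ∈ m, 0 < (α b).orderTop}, a ≠ b → ∃ j, ∀ i, (a.1 (g j) - b.1 (g j)).orderTop < ((φ a i - φ b i) - (a.1 (g i) - b.1 (g i))).orderTop) → (∀ a, ∀ w : J → HahnSeries ℚ k, (∀ i, 0 < (w i).orderTop) → w ∈ Submodule.span (HahnSeries ℚ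 k) ((fun u : J → k => fun i => HahnSeries.C (u i)) '' (W : Set (J → k))) → ∃ b, φ b = φ a + w) → ∀ (P : MvPolynomial J k), MvPolynomial.aeval g P = 0 → ∀ (d₀ : ℕ), (∀ d ∈ P.support, d₀ ≤ d.degree) → ∀ (a : {α : ↥B →ₐ[k] HahnSeries ℚ k // ∀ b ∈ m, 0 < (α b).orderTop}) (e : ℚ), 0 < e → (∀ i, (e : WithTop ℚ) ≤ (a.1 (g i)).orderTop) → ∀ u ∈ W, MvPolynomial.eval (fun i => (a.1 (g i)).coeff e + u i) (MvPolynomial.homogeneousComponent d₀ P) = 0 := by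
  intro k _ K _ _ B m J g W φ h1 h3 P hP d₀ hd₀ a e he hae u hu
  set cc : {α : ↥B →ₐ[k] HahnSeries ℚ k // ∀ b ∈ m, 0 < (α b).orderTop} → J → HahnSeries ℚ k :=
    fun b i => b.1 (g i) with hcc
  have hP' : ∀ b : {α : ↥B →ₐ[k] HahnSeries ℚ k // ∀ b ∈ m, 0 < (α b).orderTop},
      MvPolynomial.aeval (cc b) P = 0 := by
    intro b
    have : MvPolynomial.aeval (cc b) P = b.1 (MvPolynomial.aeval g P) := by
      rw [hcc, ← AlgHom.comp_apply, MvPolynomial.comp_aeval]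
    rw [this, hP, map_zero]
  have h1' : ∀ a b : {α : ↥B →ₐ[k] HahnSeries ℚ k // ∀ b ∈ m, 0 < (α b).orderTop}, a ≠ b →
      ∃ j, ∀ i, (cc a j - cc b j).orderTop < ((φ a i - φ b i) - (cc a i - cc b i)).orderTop := h1
  have hae' : ∀ i, (e : WithTop ℚ) ≤ (cc a i).orderTop := hae
  exact cone_initialForm h1' h3 P hP' d₀ hd₀ a he hae' hu

end Route

end Summit.ResolutionOfSingularities.ResolutionOfSingularities.Theorems

end
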